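import Mathlib
import Summits.Ventures.PercRepro2.Defs
import Summits.Ventures.PercRepro2.Independence
import Summits.Ventures.PercRepro2.Harris
import Summits.Ventures.PercRepro2.CoinDefs
import Summits.Ventures.PercRepro2.CoinArcsOff
import Summits.Ventures.PercRepro2.CoinPendantDefs
import Summits.Ventures.PercRepro2.CoinPendant
import Summits.Ventures.PercRepro2.CoinInduced
import Summits.Ventures.PercRepro2.CoinVdBK
import Summits.Ventures.PercRepro2.CoinBHK
import Summits.Ventures.PercRepro2.CoinReverse
import Summits.Ventures.PercRepro2.CoinLemmaA
import Summits.Ventures.PercRepro2.CoinDarcMixed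
import Summits.Ventures.PercRepro2.CoinTwoPendantDefs
import Summits.Ventures.PercRepro2.CoinTwoPendantMass
import Summits.Ventures.PercRepro2.CoinTraceLevels
import Summits.Ventures.PercRepro2.CoinTraceTower
import Summits.Ventures.PercRepro2.CoinTracePin
import Summits.Ventures.PercRepro2.CoinTracePin2
import Summits.Ventures.PercRepro2.CoinTraceReduce
import Summits.Ventures.PercRepro2.CoinTraceFn
import Summits.Ventures.PercRepro2.CoinTraceBlock
import Summits.Ventures.PercRepro2.CoinTraceShift
import Summits.Ventures.PercRepro2.CoinTwoStarAbstract
import Summits.Ventures.PercRepro2.CoinTwoStar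
import Summits.Ventures.PercRepro2.CoinTraceBlocks
import Summits.Ventures.PercRepro2.CoinGoodDecomp
import Summits.Ventures.PercRepro2.CoinPathStar
import Summits.Ventures.PercRepro2.CoinTwoChainsAbstract
import Summits.Ventures.PercRepro2.CoinPathStar
import Summits.Ventures.PercRepro2.CoinTwoChains
import Summits.Ventures.PercRepro2.CoinTracePinTransfer
import Summits.Ventures.PercRepro2.CoinLayerCake
import Summits.Ventures.PercRepro2.CoinTwoChainsHard
import Summits.Ventures.PercRepro2.CoinTwoChainsHardCD
import Summits.Ventures.PercRepro2.CoinTwoChainsAbstract2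

/-!
# Row 2′DARC at the head with TWO CHAINS OF LENGTH 2 on ALL regimes (blind cell PercRepro2,
night-2 g4; proofs/NIGHT2-DARC.md §24.3)

`P = {w, v₁, v₂, v₃, v₄}` with `w → v₁ → v₂ → t`, `w → v₃ → v₄ → t` (leaves `v₂`, `v₄` decided by
the single pendant coins `e₃`, `e₆`; the inner vertices `v₁`, `v₃` by the coin pairs `e₂e₃`,
`e₅e₆`; the route implications; the head reaching `t` only through a full route).  The two
subadditivity hypotheses of `darc_of_twoChains_mixed_of_subadd` (g3, §19.7) are REMOVED: the
abstract lemma `twoChains_functional_nonneg'` (finite layer cake over the ten pivotal up-sets,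
the three union-type ones by the case split of §23) needs the (CU-PA) inputs on the pair
cylinders `{v₁, v₄}`, `{v₃, v₂}`, `{v₂, v₄}`, supplied by the pinning transfer
(`trace_cu_pa_pair₂`, `trace_cu_pa_pair`).
-/

namespace Summit.Ventures.PercRepro2.Coin

section TwoChainsAll

open Classical

variable {V : Type*} {E : Type*} [Fintype V] [DecidableEq V] [Fintype E] [DecidableEq E]
  {R : Type*} [Field R] [LinearOrder R] [IsStrictOrderedRing R]

/-- **THEOREM (two chains of length 2, ALL regimes).** -/
theorem darc_of_twoChains_mixed (p : E → R) (hp : IsProbVec p)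
    {arcs : E → Finset (V × V)} (hS : SameEnds arcs) (s a b u w v₁ v₂ v₃ v₄ t : V)
    (hwv₁ : w ≠ v₁) (hwv₂ : w ≠ v₂) (hwv₃ : w ≠ v₃) (hwv₄ : w ≠ v₄) (hv₁₂ : v₁ ≠ v₂)
    (hv₁₃ : v₁ ≠ v₃) (hv₁₄ : v₁ ≠ v₄) (hv₂₃ : v₂ ≠ v₃) (hv₂₄ : v₂ ≠ v₄) (hv₃₄ : v₃ ≠ v₄)
    (hclosed : ClosedOut arcs ({w, v₁, v₂, v₃, v₄} : Finset V) {t}) (hT : TailCoinsIn arcs ({w, v₁, v₂, v₃, v₄} : Finset V) {t})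
    {e₂ e₃ e₅ e₆ : E} (hne₂₃ : e₂ ≠ e₃) (hne₅₆ : e₅ ≠ e₆)
    (hc₂ : e₂ ∈ tailCoins arcs ({w, v₁, v₂, v₃, v₄} : Finset V)) (hc₃ : e₃ ∈ tailCoins arcs ({w, v₁, v₂, v₃, v₄} : Finset V))
    (hc₅ : e₅ ∈ tailCoins arcs ({w, v₁, v₂, v₃, v₄} : Finset V)) (hc₆ : e₆ ∈ tailCoins arcs ({w, v₁, v₂, v₃, v₄} : Finset V))
    (hleaf₁ : bwdEvent arcs v₁ {t} = openEdge e₂ ∩ openEdge e₃)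
    (hleaf₂ : bwdEvent arcs v₂ {t} = openEdge e₃)
    (hleaf₃ : bwdEvent arcs v₃ {t} = openEdge e₅ ∩ openEdge e₆)
    (hleaf₄ : bwdEvent arcs v₄ {t} = openEdge e₆)
    (himp₁₂ : ∀ ω : Config E, ω ∈ bwdEvent arcs v₁ {t} → ω ∈ bwdEvent arcs v₂ {t})
    (himp₃₄ : ∀ ω : Config E, ω ∈ bwdEvent arcs v₃ {t} → ω ∈ bwdEvent arcs v₄ {t})
    (hexit : ∀ ω : Config E, ω ∈ bwdEvent arcs w {t} →
      (ω ∈ bwdEvent arcs v₁ {t} ∧ ω ∈ bwdEvent arcs v₂ {t}) ∨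
        (ω ∈ bwdEvent arcs v₃ {t} ∧ ω ∈ bwdEvent arcs v₄ {t}))
    (ha : a ∉ ({w, v₁, v₂, v₃, v₄} : Finset V) ∪ {t}) (hb : b ∉ ({w, v₁, v₂, v₃, v₄} : Finset V) ∪ {t}) (hu : u ∉ ({w, v₁, v₂, v₃, v₄} : Finset V) ∪ {t})
    (hP : ∀ Z ∈ ({w, v₁, v₂, v₃, v₄} : Finset V).powerset, 0 < prob p (avoidEvent (arcsOff arcs (({w, v₁, v₂, v₃, v₄} : Finset V) ∪ {t})) s (Z ∪ {t})))
    (hQ : ∀ Z ∈ ({w, v₁, v₂, v₃, v₄} : Finset V).powerset,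
      0 < prob p (avoidEvent (arcsOff arcs (({w, v₁, v₂, v₃, v₄} : Finset V) ∪ {t})) s (gateTarget u w Z {t}))) :
    DARC p arcs s {t} a b u w := by
  have hwP : w ∈ ({w, v₁, v₂, v₃, v₄} : Finset V) := by simp
  have hv₁P : v₁ ∈ ({w, v₁, v₂, v₃, v₄} : Finset V) := by simp
  have hv₂P : v₂ ∈ ({w, v₁, v₂, v₃, v₄} : Finset V) := by simp
  have hv₃P : v₃ ∈ ({w, v₁, v₂, v₃, v₄} : Finset V) := by simp
  have hv₄P : v₄ ∈ ({w, v₁, v₂, v₃, v₄} : Finset V) := by simp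
  have hS₀ : SameEnds (arcsOff arcs (({w, v₁, v₂, v₃, v₄} : Finset V) ∪ {t})) := sameEnds_arcsOff hS _
  refine darc_of_trace_functional p hp hS hclosed hT s a b u w hwP ha hb hu hQ ?_
  set D₀ := arcsOff arcs (({w, v₁, v₂, v₃, v₄} : Finset V) ∪ {t}) with hD₀
  set X₀ : Config E → R := marker D₀ s a with hX₀
  set Y₀ : Config E → R := marker D₀ s b with hY₀
  set ℓ : Finset V → R := fun Z => prob p (traceLevel arcs {t} ({w, v₁, v₂, v₃, v₄} : Finset V) Z) with hℓ
  set Pz : Finset V → R := fun Z => prob p (avoidEvent D₀ s (Z ∪ {t})) with hPz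
  set Qz : Finset V → R := fun Z => prob p (avoidEvent D₀ s (gateTarget u w Z {t})) with hQz
  set Az : Finset V → R := fun Z => massE p X₀ (avoidEvent D₀ s (Z ∪ {t})) with hAz
  set Bz : Finset V → R := fun Z => massE p Y₀ (avoidEvent D₀ s (Z ∪ {t})) with hBz
  set Ahz : Finset V → R := fun Z => massE p X₀ (avoidEvent D₀ s (gateTarget u w Z {t})) with hAhz
  set Bhz : Finset V → R := fun Z => massE p Y₀ (avoidEvent D₀ s (gateTarget u w Z {t})) with hBhz
  have hPpos : ∀ Z : Finset V, Z ⊆ ({w, v₁, v₂, v₃, v₄} : Finset V) → 0 < Pz Z := fun Z hZ => hP Z (Finset.mem_powerset.mpr hZ)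
  have hQpos : ∀ Z : Finset V, Z ⊆ ({w, v₁, v₂, v₃, v₄} : Finset V) → 0 < Qz Z := fun Z hZ => hQ Z (Finset.mem_powerset.mpr hZ)
  have hMX : ∑ Z ∈ ({w, v₁, v₂, v₃, v₄} : Finset V).powerset, Az Z / Pz Z * (ℓ Z * Pz Z) = ∑ Z ∈ ({w, v₁, v₂, v₃, v₄} : Finset V).powerset, ℓ Z * Az Z := by
    refine Finset.sum_congr rfl fun Z hZ => ?_
    have := (hPpos Z (Finset.mem_powerset.mp hZ)).ne'
    field_simp
  have hMY : ∑ Z ∈ ({w, v₁, v₂, v₃, v₄} : Finset V).powerset, Bz Z / Pz Z * (ℓ Z * Pz Z) = ∑ Z ∈ ({w, v₁, v₂, v₃, v₄} : Finset V).powerset, ℓ Z * Bz Z := by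
    refine Finset.sum_congr rfl fun Z hZ => ?_
    have := (hPpos Z (Finset.mem_powerset.mp hZ)).ne'
    field_simp
  have key : ∑ Z ∈ ({w, v₁, v₂, v₃, v₄} : Finset V).powerset, ℓ Z * Pz Z * (Qz Z / Pz Z) *
        (Ahz Z / Qz Z * (∑ Z' ∈ ({w, v₁, v₂, v₃, v₄} : Finset V).powerset, ℓ Z' * Pz Z')
          - ∑ Z' ∈ ({w, v₁, v₂, v₃, v₄} : Finset V).powerset, Az Z' / Pz Z' * (ℓ Z' * Pz Z')) *
        (Bhz Z / Qz Z * (∑ Z' ∈ ({w, v₁, v₂, v₃, v₄} : Finset V).powerset, ℓ Z' * Pz Z')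
          - ∑ Z' ∈ ({w, v₁, v₂, v₃, v₄} : Finset V).powerset, Bz Z' / Pz Z' * (ℓ Z' * Pz Z')) =
      ∑ Z ∈ ({w, v₁, v₂, v₃, v₄} : Finset V).powerset, ℓ Z * Qz Z *
        (Ahz Z / Qz Z * (∑ Z' ∈ ({w, v₁, v₂, v₃, v₄} : Finset V).powerset, ℓ Z' * Pz Z') - ∑ Z' ∈ ({w, v₁, v₂, v₃, v₄} : Finset V).powerset, ℓ Z' * Az Z') *
        (Bhz Z / Qz Z * (∑ Z' ∈ ({w, v₁, v₂, v₃, v₄} : Finset V).powerset, ℓ Z' * Pz Z') - ∑ Z' ∈ ({w, v₁, v₂, v₃, v₄} : Finset V).powerset, ℓ Z' * Bz Z') := by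
    rw [hMX, hMY]
    refine Finset.sum_congr rfl fun Z hZ => ?_
    have := (hPpos Z (Finset.mem_powerset.mp hZ)).ne'
    field_simp
  rw [← key]
  have hμ : ∀ Z ∈ ({w, v₁, v₂, v₃, v₄} : Finset V).powerset, 0 ≤ ℓ Z * Pz Z :=
    fun Z _ => mul_nonneg (prob_nonneg hp _) (prob_nonneg hp _)
  have hx1 : ∀ Z : Finset V, Z ⊆ ({w, v₁, v₂, v₃, v₄} : Finset V) → Az Z / Pz Z ≤ 1 := fun Z hZ =>
    (div_le_one₀ (hPpos Z hZ)).mpr (massE_marker_le_prob p hp D₀ s a _)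
  have hy1 : ∀ Z : Finset V, Z ⊆ ({w, v₁, v₂, v₃, v₄} : Finset V) → Bz Z / Pz Z ≤ 1 := fun Z hZ =>
    (div_le_one₀ (hPpos Z hZ)).mpr (massE_marker_le_prob p hp D₀ s b _)
  have hxh1 : ∀ Z : Finset V, Z ⊆ ({w, v₁, v₂, v₃, v₄} : Finset V) → Ahz Z / Qz Z ≤ 1 := fun Z hZ =>
    (div_le_one₀ (hQpos Z hZ)).mpr (massE_marker_le_prob p hp D₀ s a _)
  have hyh1 : ∀ Z : Finset V, Z ⊆ ({w, v₁, v₂, v₃, v₄} : Finset V) → Bhz Z / Qz Z ≤ 1 := fun Z hZ =>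
    (div_le_one₀ (hQpos Z hZ)).mpr (massE_marker_le_prob p hp D₀ s b _)
  have hxanti : ∀ Z Z' : Finset V, Z ⊆ Z' → Z' ⊆ ({w, v₁, v₂, v₃, v₄} : Finset V) → Az Z' / Pz Z' ≤ Az Z / Pz Z :=
    fun Z Z' hZZ' hZ'P => (div_le_div_iff₀ (hPpos Z' hZ'P) (hPpos Z (hZZ'.trans hZ'P))).mpr
      (shift_avoid_more_C p hp hS₀ s a (Finset.union_subset_union_left hZZ'))
  have hyanti : ∀ Z Z' : Finset V, Z ⊆ Z' → Z' ⊆ ({w, v₁, v₂, v₃, v₄} : Finset V) → Bz Z' / Pz Z' ≤ Bz Z / Pz Z :=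
    fun Z Z' hZZ' hZ'P => (div_le_div_iff₀ (hPpos Z' hZ'P) (hPpos Z (hZZ'.trans hZ'P))).mpr
      (shift_avoid_more_C p hp hS₀ s b (Finset.union_subset_union_left hZZ'))
  have hxhanti : ∀ Z Z' : Finset V, Z ⊆ Z' → Z' ⊆ ({w, v₁, v₂, v₃, v₄} : Finset V) → Ahz Z' / Qz Z' ≤ Ahz Z / Qz Z :=
    fun Z Z' hZZ' hZ'P => (div_le_div_iff₀ (hQpos Z' hZ'P) (hQpos Z (hZZ'.trans hZ'P))).mpr
      (shift_avoid_more_C p hp hS₀ s a (gateTarget_mono u w hZZ' {t}))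
  have hyhanti : ∀ Z Z' : Finset V, Z ⊆ Z' → Z' ⊆ ({w, v₁, v₂, v₃, v₄} : Finset V) → Bhz Z' / Qz Z' ≤ Bhz Z / Qz Z :=
    fun Z Z' hZZ' hZ'P => (div_le_div_iff₀ (hQpos Z' hZ'P) (hQpos Z (hZZ'.trans hZ'P))).mpr
      (shift_avoid_more_C p hp hS₀ s b (gateTarget_mono u w hZZ' {t}))
  have hxh_le : ∀ Z : Finset V, Z ⊆ ({w, v₁, v₂, v₃, v₄} : Finset V) → Ahz Z / Qz Z ≤ Az Z / Pz Z := fun Z hZ =>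
    (div_le_div_iff₀ (hQpos Z hZ) (hPpos Z hZ)).mpr
      (shift_avoid_more_C p hp hS₀ s a (subset_gateTarget u w Z {t}))
  have hyh_le : ∀ Z : Finset V, Z ⊆ ({w, v₁, v₂, v₃, v₄} : Finset V) → Bhz Z / Qz Z ≤ Bz Z / Pz Z := fun Z hZ =>
    (div_le_div_iff₀ (hQpos Z hZ) (hPpos Z hZ)).mpr
      (shift_avoid_more_C p hp hS₀ s b (subset_gateTarget u w Z {t}))
  have hxh_eq : ∀ Z : Finset V, Z ⊆ ({w, v₁, v₂, v₃, v₄} : Finset V) → w ∉ Z → Ahz Z / Qz Z = Az Z / Pz Z := by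
    intro Z _ hwZ
    show massE p X₀ (avoidEvent D₀ s (gateTarget u w Z {t})) /
        prob p (avoidEvent D₀ s (gateTarget u w Z {t})) = _
    rw [gateTarget_of_notMem hwZ]
  have hyh_eq : ∀ Z : Finset V, Z ⊆ ({w, v₁, v₂, v₃, v₄} : Finset V) → w ∉ Z → Bhz Z / Qz Z = Bz Z / Pz Z := by
    intro Z _ hwZ
    show massE p Y₀ (avoidEvent D₀ s (gateTarget u w Z {t})) /
        prob p (avoidEvent D₀ s (gateTarget u w Z {t})) = _
    rw [gateTarget_of_notMem hwZ]
  have hρ1 : ∀ Z ∈ ({w, v₁, v₂, v₃, v₄} : Finset V).powerset, w ∉ Z → Qz Z / Pz Z = 1 := by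
    intro Z hZ hwZ
    show prob p (avoidEvent D₀ s (gateTarget u w Z {t})) / prob p (avoidEvent D₀ s (Z ∪ {t})) = 1
    rw [gateTarget_of_notMem hwZ]
    exact div_self (hP Z hZ).ne'
  have hμ0a : ∀ Z ∈ ({w, v₁, v₂, v₃, v₄} : Finset V).powerset, v₁ ∈ Z → v₂ ∉ Z → ℓ Z * Pz Z = 0 := by
    intro Z _ h1 h2
    have : ℓ Z = 0 := by
      show prob p (traceLevel arcs {t} ({w, v₁, v₂, v₃, v₄} : Finset V) Z) = 0
      rw [traceLevel_eq_empty_of_implies hv₁P hv₂P himp₁₂ h1 h2, prob_empty]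
    rw [this, zero_mul]
  have hμ0b : ∀ Z ∈ ({w, v₁, v₂, v₃, v₄} : Finset V).powerset, v₃ ∈ Z → v₄ ∉ Z → ℓ Z * Pz Z = 0 := by
    intro Z _ h3 h4
    have : ℓ Z = 0 := by
      show prob p (traceLevel arcs {t} ({w, v₁, v₂, v₃, v₄} : Finset V) Z) = 0
      rw [traceLevel_eq_empty_of_implies hv₃P hv₄P himp₃₄ h3 h4, prob_empty]
    rw [this, zero_mul]
  have hμ0c : ∀ Z ∈ ({w, v₁, v₂, v₃, v₄} : Finset V).powerset, w ∈ Z → ¬ (v₁ ∈ Z ∧ v₂ ∈ Z) → ¬ (v₃ ∈ Z ∧ v₄ ∈ Z) →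
      ℓ Z * Pz Z = 0 := by
    intro Z _ hw h12 h34
    have : ℓ Z = 0 := by
      show prob p (traceLevel arcs {t} ({w, v₁, v₂, v₃, v₄} : Finset V) Z) = 0
      rw [traceLevel_eq_empty_of_two_routes hwP hv₁P hv₂P hv₃P hv₄P hexit hw h12 h34, prob_empty]
    rw [this, zero_mul]
  -- the positive-association inputs
  have hPA : TracePA ({w, v₁, v₂, v₃, v₄} : Finset V) (fun Z => ℓ Z * Pz Z) := by
    intro U hU f₁ f₂ h₁ h₂ h₁0 h₂0
    have h := trace_pa p hp hS hclosed hT hU s (monotone_traceFn ({w, v₁, v₂, v₃, v₄} : Finset V) h₁) (monotone_traceFn ({w, v₁, v₂, v₃, v₄} : Finset V) h₂)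
      (traceFn_nonneg ({w, v₁, v₂, v₃, v₄} : Finset V) h₁0) (traceFn_nonneg ({w, v₁, v₂, v₃, v₄} : Finset V) h₂0)
    have e₁ : ∑ Z ∈ ({w, v₁, v₂, v₃, v₄} : Finset V).powerset.filter (fun Z => Disjoint Z U),
        traceFn ({w, v₁, v₂, v₃, v₄} : Finset V) f₁ ↑Z * (ℓ Z * Pz Z) =
        ∑ Z ∈ ({w, v₁, v₂, v₃, v₄} : Finset V).powerset.filter (fun Z => Disjoint Z U), f₁ Z * (ℓ Z * Pz Z) :=
      Finset.sum_congr rfl fun Z hZ => by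
        rw [traceFn_coe ({w, v₁, v₂, v₃, v₄} : Finset V) f₁ (Finset.mem_powerset.mp (Finset.mem_filter.mp hZ).1)]
    have e₂ : ∑ Z ∈ ({w, v₁, v₂, v₃, v₄} : Finset V).powerset.filter (fun Z => Disjoint Z U),
        traceFn ({w, v₁, v₂, v₃, v₄} : Finset V) f₂ ↑Z * (ℓ Z * Pz Z) =
        ∑ Z ∈ ({w, v₁, v₂, v₃, v₄} : Finset V).powerset.filter (fun Z => Disjoint Z U), f₂ Z * (ℓ Z * Pz Z) :=
      Finset.sum_congr rfl fun Z hZ => by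
        rw [traceFn_coe ({w, v₁, v₂, v₃, v₄} : Finset V) f₂ (Finset.mem_powerset.mp (Finset.mem_filter.mp hZ).1)]
    have e₁₂ : ∑ Z ∈ ({w, v₁, v₂, v₃, v₄} : Finset V).powerset.filter (fun Z => Disjoint Z U),
        traceFn ({w, v₁, v₂, v₃, v₄} : Finset V) f₁ ↑Z * traceFn ({w, v₁, v₂, v₃, v₄} : Finset V) f₂ ↑Z * (ℓ Z * Pz Z) =
        ∑ Z ∈ ({w, v₁, v₂, v₃, v₄} : Finset V).powerset.filter (fun Z => Disjoint Z U), f₁ Z * f₂ Z * (ℓ Z * Pz Z) :=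
      Finset.sum_congr rfl fun Z hZ => by
        rw [traceFn_coe ({w, v₁, v₂, v₃, v₄} : Finset V) f₁ (Finset.mem_powerset.mp (Finset.mem_filter.mp hZ).1),
          traceFn_coe ({w, v₁, v₂, v₃, v₄} : Finset V) f₂ (Finset.mem_powerset.mp (Finset.mem_filter.mp hZ).1)]
    rw [e₁, e₂, e₁₂] at h
    exact h
  have hCUconv : ∀ (v : V) (f₁ f₂ : Finset V → R),
      (∑ Z ∈ ({w, v₁, v₂, v₃, v₄} : Finset V).powerset.filter (fun Z => v ∈ Z),
          traceFn ({w, v₁, v₂, v₃, v₄} : Finset V) f₁ ↑Z * (ℓ Z * Pz Z)) *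
        (∑ Z ∈ ({w, v₁, v₂, v₃, v₄} : Finset V).powerset.filter (fun Z => v ∈ Z), traceFn ({w, v₁, v₂, v₃, v₄} : Finset V) f₂ ↑Z * (ℓ Z * Pz Z)) ≤
      (∑ Z ∈ ({w, v₁, v₂, v₃, v₄} : Finset V).powerset.filter (fun Z => v ∈ Z),
          traceFn ({w, v₁, v₂, v₃, v₄} : Finset V) f₁ ↑Z * traceFn ({w, v₁, v₂, v₃, v₄} : Finset V) f₂ ↑Z * (ℓ Z * Pz Z)) *
        ∑ Z ∈ ({w, v₁, v₂, v₃, v₄} : Finset V).powerset.filter (fun Z => v ∈ Z), ℓ Z * Pz Z →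
      (∑ Z ∈ ({w, v₁, v₂, v₃, v₄} : Finset V).powerset.filter (fun Z => v ∈ Z), f₁ Z * (ℓ Z * Pz Z)) *
        (∑ Z ∈ ({w, v₁, v₂, v₃, v₄} : Finset V).powerset.filter (fun Z => v ∈ Z), f₂ Z * (ℓ Z * Pz Z)) ≤
      (∑ Z ∈ ({w, v₁, v₂, v₃, v₄} : Finset V).powerset.filter (fun Z => v ∈ Z), f₁ Z * f₂ Z * (ℓ Z * Pz Z)) *
        ∑ Z ∈ ({w, v₁, v₂, v₃, v₄} : Finset V).powerset.filter (fun Z => v ∈ Z), ℓ Z * Pz Z := by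
    intro v f₁ f₂ h
    have e₁ : ∑ Z ∈ ({w, v₁, v₂, v₃, v₄} : Finset V).powerset.filter (fun Z => v ∈ Z), traceFn ({w, v₁, v₂, v₃, v₄} : Finset V) f₁ ↑Z * (ℓ Z * Pz Z) =
        ∑ Z ∈ ({w, v₁, v₂, v₃, v₄} : Finset V).powerset.filter (fun Z => v ∈ Z), f₁ Z * (ℓ Z * Pz Z) :=
      Finset.sum_congr rfl fun Z hZ => by
        rw [traceFn_coe ({w, v₁, v₂, v₃, v₄} : Finset V) f₁ (Finset.mem_powerset.mp (Finset.mem_filter.mp hZ).1)]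
    have e₂ : ∑ Z ∈ ({w, v₁, v₂, v₃, v₄} : Finset V).powerset.filter (fun Z => v ∈ Z), traceFn ({w, v₁, v₂, v₃, v₄} : Finset V) f₂ ↑Z * (ℓ Z * Pz Z) =
        ∑ Z ∈ ({w, v₁, v₂, v₃, v₄} : Finset V).powerset.filter (fun Z => v ∈ Z), f₂ Z * (ℓ Z * Pz Z) :=
      Finset.sum_congr rfl fun Z hZ => by
        rw [traceFn_coe ({w, v₁, v₂, v₃, v₄} : Finset V) f₂ (Finset.mem_powerset.mp (Finset.mem_filter.mp hZ).1)]
    have e₁₂ : ∑ Z ∈ ({w, v₁, v₂, v₃, v₄} : Finset V).powerset.filter (fun Z => v ∈ Z),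
        traceFn ({w, v₁, v₂, v₃, v₄} : Finset V) f₁ ↑Z * traceFn ({w, v₁, v₂, v₃, v₄} : Finset V) f₂ ↑Z * (ℓ Z * Pz Z) =
        ∑ Z ∈ ({w, v₁, v₂, v₃, v₄} : Finset V).powerset.filter (fun Z => v ∈ Z), f₁ Z * f₂ Z * (ℓ Z * Pz Z) :=
      Finset.sum_congr rfl fun Z hZ => by
        rw [traceFn_coe ({w, v₁, v₂, v₃, v₄} : Finset V) f₁ (Finset.mem_powerset.mp (Finset.mem_filter.mp hZ).1),
          traceFn_coe ({w, v₁, v₂, v₃, v₄} : Finset V) f₂ (Finset.mem_powerset.mp (Finset.mem_filter.mp hZ).1)]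
    rw [e₁, e₂, e₁₂] at h
    exact h
  have hCU₁ : TraceCUPA ({w, v₁, v₂, v₃, v₄} : Finset V) (fun Z => ℓ Z * Pz Z) v₁ := fun f₁ f₂ h₁ h₂ h₁0 h₂0 =>
    hCUconv v₁ f₁ f₂ (trace_cu_pa₂ p hp hS hclosed hT hv₁P hne₂₃ hc₂ hc₃ hleaf₁ s
      (monotone_traceFn ({w, v₁, v₂, v₃, v₄} : Finset V) h₁) (monotone_traceFn ({w, v₁, v₂, v₃, v₄} : Finset V) h₂) (traceFn_nonneg ({w, v₁, v₂, v₃, v₄} : Finset V) h₁0)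
      (traceFn_nonneg ({w, v₁, v₂, v₃, v₄} : Finset V) h₂0))
  have hCU₂ : TraceCUPA ({w, v₁, v₂, v₃, v₄} : Finset V) (fun Z => ℓ Z * Pz Z) v₂ := fun f₁ f₂ h₁ h₂ h₁0 h₂0 =>
    hCUconv v₂ f₁ f₂ (trace_cu_pa p hp hS hclosed hT hv₂P hc₃ hleaf₂ s
      (monotone_traceFn ({w, v₁, v₂, v₃, v₄} : Finset V) h₁) (monotone_traceFn ({w, v₁, v₂, v₃, v₄} : Finset V) h₂) (traceFn_nonneg ({w, v₁, v₂, v₃, v₄} : Finset V) h₁0)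
      (traceFn_nonneg ({w, v₁, v₂, v₃, v₄} : Finset V) h₂0))
  have hCU₃ : TraceCUPA ({w, v₁, v₂, v₃, v₄} : Finset V) (fun Z => ℓ Z * Pz Z) v₃ := fun f₁ f₂ h₁ h₂ h₁0 h₂0 =>
    hCUconv v₃ f₁ f₂ (trace_cu_pa₂ p hp hS hclosed hT hv₃P hne₅₆ hc₅ hc₆ hleaf₃ s
      (monotone_traceFn ({w, v₁, v₂, v₃, v₄} : Finset V) h₁) (monotone_traceFn ({w, v₁, v₂, v₃, v₄} : Finset V) h₂) (traceFn_nonneg ({w, v₁, v₂, v₃, v₄} : Finset V) h₁0)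
      (traceFn_nonneg ({w, v₁, v₂, v₃, v₄} : Finset V) h₂0))
  have hCU₄ : TraceCUPA ({w, v₁, v₂, v₃, v₄} : Finset V) (fun Z => ℓ Z * Pz Z) v₄ := fun f₁ f₂ h₁ h₂ h₁0 h₂0 =>
    hCUconv v₄ f₁ f₂ (trace_cu_pa p hp hS hclosed hT hv₄P hc₆ hleaf₄ s
      (monotone_traceFn ({w, v₁, v₂, v₃, v₄} : Finset V) h₁) (monotone_traceFn ({w, v₁, v₂, v₃, v₄} : Finset V) h₂) (traceFn_nonneg ({w, v₁, v₂, v₃, v₄} : Finset V) h₁0)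
      (traceFn_nonneg ({w, v₁, v₂, v₃, v₄} : Finset V) h₂0))
  have hρ0 : ∀ Z ∈ ({w, v₁, v₂, v₃, v₄} : Finset V).powerset, 0 ≤ Qz Z / Pz Z :=
    fun Z _ => div_nonneg (prob_nonneg hp _) (prob_nonneg hp _)
  have hρle' : ∀ Z ∈ ({w, v₁, v₂, v₃, v₄} : Finset V).powerset, Qz Z / Pz Z ≤ 1 := fun Z hZ =>
    (div_le_one₀ (hPpos Z (Finset.mem_powerset.mp hZ))).mpr
      (prob_mono hp fun ω hω t' ht' => hω t' (subset_gateTarget u w Z {t} ht'))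
  have hρmono : ∀ Z ∈ ({w, v₁, v₂, v₃, v₄} : Finset V).powerset,
      ∀ Z' ∈ ({w, v₁, v₂, v₃, v₄} : Finset V).powerset, w ∈ Z → Z ⊆ Z' → Qz Z / Pz Z ≤ Qz Z' / Pz Z' :=
    fun Z hZ Z' hZ' hwZ hZZ' =>
      (div_le_div_iff₀ (hPpos Z (Finset.mem_powerset.mp hZ)) (hPpos Z' (Finset.mem_powerset.mp hZ'))).mpr
        (rho_mono_of_subset p hp hS s u w hu hZZ' (Finset.mem_powerset.mp hZ') hwZ)
  -- the pair cylinders, by the pinning transfer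
  have hCUconvQ : ∀ (Q : Finset V → Prop) [DecidablePred Q] (f₁ f₂ : Finset V → R),
      (∑ Z ∈ ({w, v₁, v₂, v₃, v₄} : Finset V).powerset.filter Q,
          traceFn ({w, v₁, v₂, v₃, v₄} : Finset V) f₁ ↑Z * (ℓ Z * Pz Z)) *
        (∑ Z ∈ ({w, v₁, v₂, v₃, v₄} : Finset V).powerset.filter Q, traceFn ({w, v₁, v₂, v₃, v₄} : Finset V) f₂ ↑Z * (ℓ Z * Pz Z)) ≤
      (∑ Z ∈ ({w, v₁, v₂, v₃, v₄} : Finset V).powerset.filter Q,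
          traceFn ({w, v₁, v₂, v₃, v₄} : Finset V) f₁ ↑Z * traceFn ({w, v₁, v₂, v₃, v₄} : Finset V) f₂ ↑Z * (ℓ Z * Pz Z)) *
        ∑ Z ∈ ({w, v₁, v₂, v₃, v₄} : Finset V).powerset.filter Q, ℓ Z * Pz Z →
      (∑ Z ∈ ({w, v₁, v₂, v₃, v₄} : Finset V).powerset.filter Q, f₁ Z * (ℓ Z * Pz Z)) *
        (∑ Z ∈ ({w, v₁, v₂, v₃, v₄} : Finset V).powerset.filter Q, f₂ Z * (ℓ Z * Pz Z)) ≤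
      (∑ Z ∈ ({w, v₁, v₂, v₃, v₄} : Finset V).powerset.filter Q, f₁ Z * f₂ Z * (ℓ Z * Pz Z)) *
        ∑ Z ∈ ({w, v₁, v₂, v₃, v₄} : Finset V).powerset.filter Q, ℓ Z * Pz Z := by
    intro Q _ f₁ f₂ h
    have e₁ : ∑ Z ∈ ({w, v₁, v₂, v₃, v₄} : Finset V).powerset.filter Q, traceFn ({w, v₁, v₂, v₃, v₄} : Finset V) f₁ ↑Z * (ℓ Z * Pz Z) =
        ∑ Z ∈ ({w, v₁, v₂, v₃, v₄} : Finset V).powerset.filter Q, f₁ Z * (ℓ Z * Pz Z) :=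
      Finset.sum_congr rfl fun Z hZ => by
        rw [traceFn_coe ({w, v₁, v₂, v₃, v₄} : Finset V) f₁ (Finset.mem_powerset.mp (Finset.mem_filter.mp hZ).1)]
    have e₂ : ∑ Z ∈ ({w, v₁, v₂, v₃, v₄} : Finset V).powerset.filter Q, traceFn ({w, v₁, v₂, v₃, v₄} : Finset V) f₂ ↑Z * (ℓ Z * Pz Z) =
        ∑ Z ∈ ({w, v₁, v₂, v₃, v₄} : Finset V).powerset.filter Q, f₂ Z * (ℓ Z * Pz Z) :=
      Finset.sum_congr rfl fun Z hZ => by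
        rw [traceFn_coe ({w, v₁, v₂, v₃, v₄} : Finset V) f₂ (Finset.mem_powerset.mp (Finset.mem_filter.mp hZ).1)]
    have e₁₂ : ∑ Z ∈ ({w, v₁, v₂, v₃, v₄} : Finset V).powerset.filter Q,
        traceFn ({w, v₁, v₂, v₃, v₄} : Finset V) f₁ ↑Z * traceFn ({w, v₁, v₂, v₃, v₄} : Finset V) f₂ ↑Z * (ℓ Z * Pz Z) =
        ∑ Z ∈ ({w, v₁, v₂, v₃, v₄} : Finset V).powerset.filter Q, f₁ Z * f₂ Z * (ℓ Z * Pz Z) :=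
      Finset.sum_congr rfl fun Z hZ => by
        rw [traceFn_coe ({w, v₁, v₂, v₃, v₄} : Finset V) f₁ (Finset.mem_powerset.mp (Finset.mem_filter.mp hZ).1),
          traceFn_coe ({w, v₁, v₂, v₃, v₄} : Finset V) f₂ (Finset.mem_powerset.mp (Finset.mem_filter.mp hZ).1)]
    rw [e₁, e₂, e₁₂] at h
    exact h
  have hCU₁₄ : ∀ f₁ f₂ : Finset V → R,
      (∀ Z Z' : Finset V, Z ⊆ Z' → Z' ⊆ ({w, v₁, v₂, v₃, v₄} : Finset V) → f₁ Z ≤ f₁ Z') →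
      (∀ Z Z' : Finset V, Z ⊆ Z' → Z' ⊆ ({w, v₁, v₂, v₃, v₄} : Finset V) → f₂ Z ≤ f₂ Z') →
      (∀ Z : Finset V, Z ⊆ ({w, v₁, v₂, v₃, v₄} : Finset V) → 0 ≤ f₁ Z) →
      (∀ Z : Finset V, Z ⊆ ({w, v₁, v₂, v₃, v₄} : Finset V) → 0 ≤ f₂ Z) →
      (∑ Z ∈ ({w, v₁, v₂, v₃, v₄} : Finset V).powerset.filter (fun Z => v₁ ∈ Z ∧ v₄ ∈ Z), f₁ Z * (ℓ Z * Pz Z)) *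
          (∑ Z ∈ ({w, v₁, v₂, v₃, v₄} : Finset V).powerset.filter (fun Z => v₁ ∈ Z ∧ v₄ ∈ Z), f₂ Z * (ℓ Z * Pz Z)) ≤
        (∑ Z ∈ ({w, v₁, v₂, v₃, v₄} : Finset V).powerset.filter (fun Z => v₁ ∈ Z ∧ v₄ ∈ Z), f₁ Z * f₂ Z * (ℓ Z * Pz Z)) *
          ∑ Z ∈ ({w, v₁, v₂, v₃, v₄} : Finset V).powerset.filter (fun Z => v₁ ∈ Z ∧ v₄ ∈ Z), ℓ Z * Pz Z :=
    fun f₁ f₂ h₁ h₂ h₁0 h₂0 => hCUconvQ (fun Z => v₁ ∈ Z ∧ v₄ ∈ Z) f₁ f₂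
      (trace_cu_pa_pair₂ p hp hS hclosed hT hv₁P hv₄P hne₂₃ hc₂ hc₃ hc₆ hleaf₁ hleaf₄ s
        (monotone_traceFn ({w, v₁, v₂, v₃, v₄} : Finset V) h₁) (monotone_traceFn ({w, v₁, v₂, v₃, v₄} : Finset V) h₂)
        (traceFn_nonneg ({w, v₁, v₂, v₃, v₄} : Finset V) h₁0) (traceFn_nonneg ({w, v₁, v₂, v₃, v₄} : Finset V) h₂0))
  have hCU₃₂ : ∀ f₁ f₂ : Finset V → R,
      (∀ Z Z' : Finset V, Z ⊆ Z' → Z' ⊆ ({w, v₁, v₂, v₃, v₄} : Finset V) → f₁ Z ≤ f₁ Z') →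
      (∀ Z Z' : Finset V, Z ⊆ Z' → Z' ⊆ ({w, v₁, v₂, v₃, v₄} : Finset V) → f₂ Z ≤ f₂ Z') →
      (∀ Z : Finset V, Z ⊆ ({w, v₁, v₂, v₃, v₄} : Finset V) → 0 ≤ f₁ Z) →
      (∀ Z : Finset V, Z ⊆ ({w, v₁, v₂, v₃, v₄} : Finset V) → 0 ≤ f₂ Z) →
      (∑ Z ∈ ({w, v₁, v₂, v₃, v₄} : Finset V).powerset.filter (fun Z => v₃ ∈ Z ∧ v₂ ∈ Z), f₁ Z * (ℓ Z * Pz Z)) *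
          (∑ Z ∈ ({w, v₁, v₂, v₃, v₄} : Finset V).powerset.filter (fun Z => v₃ ∈ Z ∧ v₂ ∈ Z), f₂ Z * (ℓ Z * Pz Z)) ≤
        (∑ Z ∈ ({w, v₁, v₂, v₃, v₄} : Finset V).powerset.filter (fun Z => v₃ ∈ Z ∧ v₂ ∈ Z), f₁ Z * f₂ Z * (ℓ Z * Pz Z)) *
          ∑ Z ∈ ({w, v₁, v₂, v₃, v₄} : Finset V).powerset.filter (fun Z => v₃ ∈ Z ∧ v₂ ∈ Z), ℓ Z * Pz Z :=
    fun f₁ f₂ h₁ h₂ h₁0 h₂0 => hCUconvQ (fun Z => v₃ ∈ Z ∧ v₂ ∈ Z) f₁ f₂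
      (trace_cu_pa_pair₂ p hp hS hclosed hT hv₃P hv₂P hne₅₆ hc₅ hc₆ hc₃ hleaf₃ hleaf₂ s
        (monotone_traceFn ({w, v₁, v₂, v₃, v₄} : Finset V) h₁) (monotone_traceFn ({w, v₁, v₂, v₃, v₄} : Finset V) h₂)
        (traceFn_nonneg ({w, v₁, v₂, v₃, v₄} : Finset V) h₁0) (traceFn_nonneg ({w, v₁, v₂, v₃, v₄} : Finset V) h₂0))
  have hCU₂₄ : ∀ f₁ f₂ : Finset V → R,
      (∀ Z Z' : Finset V, Z ⊆ Z' → Z' ⊆ ({w, v₁, v₂, v₃, v₄} : Finset V) → f₁ Z ≤ f₁ Z') →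
      (∀ Z Z' : Finset V, Z ⊆ Z' → Z' ⊆ ({w, v₁, v₂, v₃, v₄} : Finset V) → f₂ Z ≤ f₂ Z') →
      (∀ Z : Finset V, Z ⊆ ({w, v₁, v₂, v₃, v₄} : Finset V) → 0 ≤ f₁ Z) →
      (∀ Z : Finset V, Z ⊆ ({w, v₁, v₂, v₃, v₄} : Finset V) → 0 ≤ f₂ Z) →
      (∑ Z ∈ ({w, v₁, v₂, v₃, v₄} : Finset V).powerset.filter (fun Z => v₂ ∈ Z ∧ v₄ ∈ Z), f₁ Z * (ℓ Z * Pz Z)) *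
          (∑ Z ∈ ({w, v₁, v₂, v₃, v₄} : Finset V).powerset.filter (fun Z => v₂ ∈ Z ∧ v₄ ∈ Z), f₂ Z * (ℓ Z * Pz Z)) ≤
        (∑ Z ∈ ({w, v₁, v₂, v₃, v₄} : Finset V).powerset.filter (fun Z => v₂ ∈ Z ∧ v₄ ∈ Z), f₁ Z * f₂ Z * (ℓ Z * Pz Z)) *
          ∑ Z ∈ ({w, v₁, v₂, v₃, v₄} : Finset V).powerset.filter (fun Z => v₂ ∈ Z ∧ v₄ ∈ Z), ℓ Z * Pz Z :=
    fun f₁ f₂ h₁ h₂ h₁0 h₂0 => hCUconvQ (fun Z => v₂ ∈ Z ∧ v₄ ∈ Z) f₁ f₂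
      (trace_cu_pa_pair p hp hS hclosed hT hv₂P hv₄P hc₃ hc₆ hleaf₂ hleaf₄ s
        (monotone_traceFn ({w, v₁, v₂, v₃, v₄} : Finset V) h₁) (monotone_traceFn ({w, v₁, v₂, v₃, v₄} : Finset V) h₂)
        (traceFn_nonneg ({w, v₁, v₂, v₃, v₄} : Finset V) h₁0) (traceFn_nonneg ({w, v₁, v₂, v₃, v₄} : Finset V) h₂0))
  exact twoChains_functional_nonneg' hwv₁ hwv₂ hwv₃ hwv₄ hv₁₂ hv₁₃ hv₁₄ hv₂₃ hv₂₄ hv₃₄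
    (fun Z => ℓ Z * Pz Z) (fun Z => Az Z / Pz Z) (fun Z => Bz Z / Pz Z) (fun Z => Ahz Z / Qz Z)
    (fun Z => Bhz Z / Qz Z) (fun Z => Qz Z / Pz Z) hμ hμ0a hμ0b hμ0c hx1 hy1 hxh1 hyh1 hxanti
    hyanti hxhanti hyhanti hxh_le hyh_le hxh_eq hyh_eq hρ1 hρ0 hρle' hρmono
    hPA hCU₁ hCU₂ hCU₃ hCU₄ hCU₁₄ hCU₃₂ hCU₂₄

end TwoChainsAll

end Summit.Ventures.PercRepro2.Coin
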